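/- Copyright: the b2b-balaban cell (near-miss cell 7), T⁴-continuum fan-out; row NE7b ROUND-2 swarm, seat
t4-ne7b-formalise-leaf-02 (gen 10) (road W-RP, sub-row «W6-opt (a)»: node test (t5) of the W-road END; INTENT journal
l.16680).  Released under the licence of the surrounding project. -/
import Summits.QuantumFields.BalabanUV.T4Continuum.Support.HistoryChessboardEventsCutoff

/-!
# Road W-RP: THE W-ROAD END FIRES ON A DECIDED TOY (node test (t5) — its antecedent is jointly satisfiable)

Summits-side support leaf of the T⁴-continuum cell (rung (B)+1 on a FINITE torus only; NOT infinite volume, NOT the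
mass gap, NOT the Clay statement; NOT a proof of the spine estimate NE7b).  Row NE7b, road **W-RP** (owner's rulings
R-OWNER-23-2∕-8: a LIVE SECONDARY road beside the COUNT road of record), sub-row «W6-opt (a)» of the claim table
`t4/b2b-balaban-t4-ne7b-p1/LEAVES-NE7b.md` (row W6 «W-ROAD APEX ∕ HEADLINE», optional toy).  A NON-VACUITY NODE TEST
of the road's END `HistoryChessboardEventsCutoff.hybridNE7_of_cutoffReadings` (p220032; = row W4's
`HistoryChessboardAssembly.hybridNE7_of_chessboard` p218970 with its readings DISCHARGED from per-cutoff event readings):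
a jointly unsatisfiable antecedent — two families of 21-clause `CutoffReading`s with SUMMABLE rates, the NE7c socket
`ShellWeightBound`, the NE7 budget `ReindexedBudget` and four summable rates — would make the END (and every apex ∕
headline composed over it) vacuously true.  This file shows it is not: the END is APPLIED in the kernel to a decided toy
and its conclusion `∃ K₁ K₂, … HybridNE7 …` obtained.  (§6 of p220032 inhabits ONE `CutoffReading` at rate `r = 1`, which
is not summable; nothing there inhabits the END's whole antecedent.  The count road's analogue is row S12h,
`HistoryRealiseCellsRunApexWitness`, p220350.)

WHAT IS BUILT [decided toy on OUR carriers; nothing of Bałaban's is modelled; Mathlib + the tree's records BY NAME].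
* §1 **`cutoffReading_unit`** — for ANY undressed weight `z > 0` and any one-term dressed family with `A t () = e^t·z`:
  the per-cutoff reading on the carrier `Unit` — Dirac state, one term `()` with event `univ`, source `obs ≡ 1`
  bounded by `ob = 1` (so the representation clause `repr` IS the identity `A t = z·∫ e^{t·1} dδ`), EMPTY cell events for
  the one pattern (so the universally forced pattern has probability `0 = 0^{N^d}`, i.e. RATE `r = 0` — summable over
  the cutoff), EMPTY bad class, identity reflections, bottom positive-half σ-algebras (reflection positivity reads
  `∫ g·g ≥ 0`), block torus `(ℤ∕2)^1`.
* §2 **`hybridNE7_toy`** — for ANY two positive sequences `z z′ : ℕ → ℝ` (run A `A K t () := e^t·z K`, run B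
  `B K t () := e^t·z′ K`): §1 at every cutoff for both runs, shells `0` (`shellWeightBound_zero`: `ShellWeightBound` with
  `Wsh ≡ 0`), the NE7 budget met WITH EQUALITY (`reindexedBudget_log`: `Cc K t () := ν K := log (z′ K ∕ z K)`,
  `Rr = CcRec = RrRec = 0`, class constant `c₀ ≡ 0`, rates `u = s₂ = rr = s = 0`) ⇒ the END
  `hybridNE7_of_cutoffReadings` APPLIED: `∃ K₁ K₂, 0 ≤ K₁ ∧ HybridNE7 1 1 …` for the toy families (weight
  `e^{2·(1·1)}·1·2^1·(0 + 0)`).  The 2 × 21-clause + NE7c + NE7 + 4-rate antecedent of the W-road END is JOINTLY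
  SATISFIABLE and the END fires in the kernel.
`hybridNE7_toy_zero` = the same with the weights
  computed (`W = Wsh = δ ≡ 0`); **`hybridNE7_of_factorising`** = the same for ANY one-term families with
  `X K t () = e^t·X K 0 ()`, `X K 0 () > 0` — the form a `ChessboardRoadWitness` toy (row W6, sub-row W6-opt (b)) consumes
  with the dressed integrals of the empty loop string on row S12h's datum (`Ztoy_eq_exp_mul`, `Ztoy_pos`, BY NAME there).
* §3 HONEST located remark, as decided `example`s: on this toy every RP ∕ (LOC) ∕ (R-sym) ∕ (EXT) field is trivial BY
  DESIGN (identity reflection, bottom σ-algebra, empty cell events, one term, no bad term); the test certifies that the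
  SHAPE composes and fires, nothing else — exactly as S12h does for the count road.

HONEST SCOPE (R-OWNER-23-2 (iii) ∕ -8, verbatim for this §W row): road W-RP produces NE7b's socket for the printed 4-d
averaging prescription modulo (U1) + (G2) + (EXT)∕(LOC) + (R-sym) + the identification «`avgFun ℰ` = (0.4)» DISPLAYED;
this file DISCHARGES NONE of them and touches no exit ∕ socket ∕ `HistoryConstants` file (c3); no constant is
specialised (c2∕c6); no `def … : Prop`, no `[cite:]`, nothing printed is asserted (trigger c1, ABSOLUTE RULE).  NE7b NOT
proved; spine 0∕9.  HONEST DEPENDENCY (cell): continuum YM on T⁴ ⇐ BetaPertH ∧ nine spine estimates (0/9 proved);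
BetaPertH ⇐ (D1) ∧ (D4) ∧ CAP+tail; G-an2-4 gates asym, D1 and NE2/3/4.  This file changes none of it.
-/

open Finset MeasureTheory Literature.Barriers.CriticalPhenomena.NonGibbs Literature.Probability.LatticeModels
open Literature.MathematicalPhysics.QuantumFieldTheory.Balaban1983to89
open T4IndicatorShell T4MatchingAssembly T4MatchingClosure
open Summit.QuantumFields.BalabanUV.T4Continuum HistoryChessboardEventsCutoff

namespace Summit.QuantumFields.BalabanUV.T4Continuum.HistoryChessboardEndWitness

noncomputable section

/-! ## §1 One term on the carrier `Unit`, empty cell events: a per-cutoff reading at rate `0` -/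

section Unit

/-- On the block torus `(ℤ∕2)^1` (two cells) the intersection of the EMPTY cell events over all cells is empty.
[decided toy] -/
theorem biInter_univ_empty {Ω : Type*} :
    (⋂ c ∈ (Finset.univ : Finset (BlockIdx 1 2)), (∅ : Set Ω)) = ∅ :=
  Set.eq_empty_of_subset_empty (Set.biInter_subset_of_mem (Finset.mem_univ (fun _ => (0 : ZMod 2))))

/-- **THE PER-CUTOFF READING ON THE CARRIER `Unit`** (module docstring §1): for any undressed weight `z > 0` and any
one-term dressed family with `A t () = e^t · z` — Dirac state, event `univ`, source `obs ≡ 1` with bound `ob = 1`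
(`repr` is the identity `A t = z · ∫ e^{t·1} dδ`), EMPTY cell events (universally forced pattern of probability `0` ⇒
rate `r = 0`), empty bad class, identity reflections, bottom positive-half σ-algebras. [decided toy] -/
theorem cutoffReading_unit {z : ℝ} (hz : 0 < z) {A : ℝ → Unit → ℝ} (hA : ∀ t, A t () = Real.exp t * z) :
    CutoffReading 1 2 ({()} : Finset Unit) ({()} : Finset Unit) A (∅ : Finset Unit) (Measure.dirac ()) z
      (fun _ => Set.univ) (fun _ => 1) 1 (fun _ _ => (∅ : Set Unit)) (fun _ _ => id) (fun _ _ => ⊥) 0 where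
  prob := Measure.dirac.isProbabilityMeasure
  Z_pos := hz
  bad_subset := Finset.empty_subset _
  ev_meas _ _ := MeasurableSet.univ
  E_meas _ _ _ := MeasurableSet.empty
  obs_meas := measurable_const
  obs_bdd _ := by simp
  ob_nonneg := zero_le_one
  repr t τ _ := by
    obtain ⟨⟩ := τ
    rw [hA t, Measure.restrict_univ, integral_dirac, mul_one, mul_comm]
  ev_cover := fun ω _ => Set.mem_iUnion₂.2 ⟨(), Finset.mem_singleton_self _, Set.mem_univ ω⟩
  bad_disj := by simp
  bad_sub := by simp
  mP_le _ _ := bot_le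
  θ_meas _ _ := measurable_id
  θ_pres _ _ := MeasurePreserving.id _
  θ_invol _ _ := rfl
  rp _ _ := fun g _ _ => integral_nonneg fun ω => mul_self_nonneg (g ω)
  loc _ _ _ _ _ _ := @MeasurableSet.empty Unit ⊥
  sym _ _ _ _ _ := Set.preimage_empty
  univ_le _ _ := by
    rw [biInter_univ_empty, measureReal_empty]
    positivity
  r_nonneg := le_rfl

/-- … as a FAMILY over the cutoff, from any threshold `K₀` on, for a positive sequence `z : ℕ → ℝ` and the dressed
families `A K t () := e^t · z K`; rate `0` at every cutoff. [decided toy] -/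
theorem cutoffReadings_unit {z : ℕ → ℝ} (hz : ∀ K, 0 < z K) (K₀ : ℕ) :
    ∀ K, K₀ ≤ K → CutoffReading 1 2 ({()} : Finset Unit) ({()} : Finset Unit)
      (fun t (_ : Unit) => Real.exp t * z K) (∅ : Finset Unit) (Measure.dirac ()) (z K)
      (fun _ => Set.univ) (fun _ => 1) 1 (fun _ _ => (∅ : Set Unit)) (fun _ _ => id) (fun _ _ => ⊥) ((fun _ => (0 : ℝ)) K) :=
  fun K _ => cutoffReading_unit (hz K) fun _ => rfl

end Unit

/-! ## §2 Two runs: zero shells, the NE7 budget with equality, zero rates ⇒ the END fires -/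

section End

variable {z z' : ℕ → ℝ}

/-- **ZERO SHELLS**: for nonnegative one-term families the NE7c socket `ShellWeightBound` holds with shell parts `0` and
shell weights `Wsh ≡ 0` (summable). [decided toy] -/
theorem shellWeightBound_zero {l₀ : ℝ} {A B : ℕ → ℝ → Unit → ℝ} (hA : ∀ K t u, 0 ≤ A K t u)
    (hB : ∀ K t u, 0 ≤ B K t u) :
    ShellWeightBound l₀ (fun _ => ({()} : Finset Unit)) A B (fun _ _ _ => 0) (fun _ _ _ => 0) fun _ => 0 where
  nonneg _ := le_rfl
  summable := summable_zero
  sh_nonneg_left _ _ _ _ _ := le_rfl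
  sh_le_left K t _ u _ := hA K t u
  sh_nonneg_right _ _ _ _ _ := le_rfl
  sh_le_right K t _ u _ := hB K t u
  left _ _ _ := by simp
  right _ _ _ := by simp

/-- **THE NE7 BUDGET WITH EQUALITY**: for the runs `A K t () := e^t·z K`, `B K t () := e^t·z′ K` (`z, z′ > 0`, shells
`0`) the re-indexed term budget `ReindexedBudget` holds with the per-term constant `Cc K t () := log (z′ K ∕ z K)` = the UV
constant `ν K`, radii `Rr = RrRec = 0`, recent constant `CcRec = 0` against the class constant `c₀ ≡ 0`, and rates
`u = s₂ = rr = s = 0`: `e^{log (z′∕z)}·e^t·z = e^t·z′`. [decided toy] -/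
theorem reindexedBudget_log (hz : ∀ K, 0 < z K) (hz' : ∀ K, 0 < z' K) {l₀ vol : ℝ} (Bad : ℕ → ℝ → Finset Unit) :
    ReindexedBudget l₀ vol (fun _ => ({()} : Finset Unit))
      (fun K t (_ : Unit) => Real.exp t * z K - 0) (fun K t (_ : Unit) => Real.exp t * z' K - 0) Bad
      (fun K _ _ => Real.log (z' K / z K)) (fun _ _ _ => 0) (fun _ _ _ => 0) (fun _ _ _ => 0)
      (fun K => Real.log (z' K / z K)) (fun _ => 0) (fun _ => 0) (fun _ => 0) (fun _ => 0) (fun _ => 0) := by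
  have key : ∀ K t, Real.exp (Real.log (z' K / z K)) * (Real.exp t * z K) = Real.exp t * z' K := by
    intro K t
    rw [Real.exp_log (div_pos (hz' K) (hz K))]
    field_simp [(hz K).ne']
  refine ⟨?_, ?_, ?_, ?_, ?_, ?_, ?_⟩
  · intro K t _ u _
    rw [sub_zero]
    exact mul_nonneg (Real.exp_pos t).le (hz K).le
  · intro K t _ u _
    rw [sub_zero, sub_zero, sub_zero, key]
  · intro K t _ u _
    rw [sub_zero, sub_zero, add_zero, key]
  · intro K t _ u _
    simp
  · intro K t _ u _
    simp
  · intro K t _ u _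
    simp
  · intro K t _ u _
    simp

/-- **THE W-ROAD END FIRES** (module docstring §2): for ANY two positive sequences `z z′ : ℕ → ℝ`, the END
`HistoryChessboardEventsCutoff.hybridNE7_of_cutoffReadings` APPLIED to §1's reading families of the runs
`A K t () := e^t·z K`, `B K t () := e^t·z′ K` (rates `0`, summable), the zero shells and the equality budget of this §,
four zero rates: its conclusion — `HybridNE7` for the toy families from some `K₁ ≥ 0` and `K₂` on, with the road's weight
`e^{2·(1·1)}·#P·N^d·(r + r′)` at `#P = 1`, `N^d = 2^1`, `r = r′ = 0`.  The END's antecedent is JOINTLY SATISFIABLE.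
A node test of a hypothesis SHAPE; discharges nothing of the nine spine estimates; NE7b NOT proved. [decided toy] -/
theorem hybridNE7_toy (hz : ∀ K, 0 < z K) (hz' : ∀ K, 0 < z' K) :
    ∃ K₁ K₂ : ℕ, 0 ≤ K₁ ∧ HybridNE7 1 1 (fun _ => ({()} : Finset Unit))
      (fun K t (_ : Unit) => Real.exp t * z (K₁ + (K₂ + K)))
      (fun K t (_ : Unit) => Real.exp t * z' (K₁ + (K₂ + K))) (fun _ _ => (∅ : Finset Unit))
      (fun K => Real.exp (2 * (1 * 1)) * ((#({()} : Finset Unit) : ℝ) * (2 : ℝ) ^ 1 *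
        ((fun _ => (0 : ℝ)) (K₁ + (K₂ + K)) + (fun _ => (0 : ℝ)) (K₁ + (K₂ + K)))))
      (fun _ _ _ => 0) (fun _ _ _ => 0) (fun _ => 0)
      (fun K => ((fun _ => (0 : ℝ)) (K₁ + (K₂ + K)) + (fun _ => (0 : ℝ)) (K₁ + (K₂ + K))) +
        ((fun _ => (0 : ℝ)) (K₁ + (K₂ + K)) + (fun _ => (0 : ℝ)) (K₁ + (K₂ + K)))) :=
  hybridNE7_of_cutoffReadings (K₀ := 0) (N := 2) (by decide) (cutoffReadings_unit hz 0) (cutoffReadings_unit hz' 0)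
    summable_zero summable_zero
    (shellWeightBound_zero (fun K t _ => mul_nonneg (Real.exp_pos t).le (hz K).le)
      (fun K t _ => mul_nonneg (Real.exp_pos t).le (hz' K).le))
    (reindexedBudget_log hz hz' _) summable_zero summable_zero summable_zero summable_zero

/-- … in particular (constant weights `z ≡ 1`, `z′ ≡ 2`): THERE IS a hybrid-NE7 datum produced by the W-road END.
[decided toy] -/
theorem exists_hybridNE7_of_end :
    ∃ (A B : ℕ → ℝ → Unit → ℝ) (W δ : ℕ → ℝ), HybridNE7 1 1 (fun _ => ({()} : Finset Unit)) A B
      (fun _ _ => (∅ : Finset Unit)) W (fun _ _ _ => 0) (fun _ _ _ => 0) (fun _ => 0) δ := by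
  obtain ⟨K₁, K₂, -, h⟩ := hybridNE7_toy (z := fun _ => 1) (z' := fun _ => 2) (fun _ => one_pos) (fun _ => two_pos)
  exact ⟨_, _, _, _, h⟩

/-- **THE SAME, WEIGHTS NORMALISED**: the toy's hybrid-NE7 datum has bad-class weight `W ≡ 0`, shell weight `Wsh ≡ 0`
and remainder `δ ≡ 0` (the road's weight `e^{2}·1·2·(0 + 0)` and rate `(0 + 0) + (0 + 0)` computed). [decided toy] -/
theorem hybridNE7_toy_zero (hz : ∀ K, 0 < z K) (hz' : ∀ K, 0 < z' K) :
    ∃ K₁ K₂ : ℕ, HybridNE7 1 1 (fun _ => ({()} : Finset Unit))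
      (fun K t (_ : Unit) => Real.exp t * z (K₁ + (K₂ + K)))
      (fun K t (_ : Unit) => Real.exp t * z' (K₁ + (K₂ + K))) (fun _ _ => (∅ : Finset Unit))
      (fun _ => 0) (fun _ _ _ => 0) (fun _ _ _ => 0) (fun _ => 0) (fun _ => 0) := by
  obtain ⟨K₁, K₂, -, h⟩ := hybridNE7_toy hz hz'
  exact ⟨K₁, K₂, by simpa using h⟩

/-- **THE END FIRES ON ANY SOURCE-FACTORISING ONE-TERM FAMILIES**: if the two runs' dressed one-term families satisfy
`X K t () = e^t · X K 0 ()` with `X K 0 () > 0` (`X = A, B`) — e.g. the dressed integrals of the EMPTY loop string on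
row S12h's χ := 1 datum, `HistoryRealiseCellsRunApexWitness.Ztoy_eq_exp_mul` ∕ `Ztoy_pos` (leaf-09 g4, p220350), taken
BY NAME by a consumer; not imported here — then the W-road END gives a hybrid-NE7 datum FOR THESE VERY FAMILIES (shifted),
weights `0`.  This is the form row W6's `ChessboardRoadWitness` toy consumes (sub-row W6-opt (b)). [decided toy] -/
theorem hybridNE7_of_factorising {A B : ℕ → ℝ → Unit → ℝ} (hA : ∀ K t, A K t () = Real.exp t * A K 0 ())
    (hB : ∀ K t, B K t () = Real.exp t * B K 0 ()) (hA0 : ∀ K, 0 < A K 0 ()) (hB0 : ∀ K, 0 < B K 0 ()) :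
    ∃ K₁ K₂ : ℕ, HybridNE7 1 1 (fun _ => ({()} : Finset Unit)) (fun K => A (K₁ + (K₂ + K)))
      (fun K => B (K₁ + (K₂ + K))) (fun _ _ => (∅ : Finset Unit))
      (fun _ => 0) (fun _ _ _ => 0) (fun _ _ _ => 0) (fun _ => 0) (fun _ => 0) := by
  have eA : A = fun K t _ => Real.exp t * A K 0 () := by
    funext K t u
    exact hA K t
  have eB : B = fun K t _ => Real.exp t * B K 0 () := by
    funext K t u
    exact hB K t
  obtain ⟨K₁, K₂, h⟩ := hybridNE7_toy_zero (z := fun K => A K 0 ()) (z' := fun K => B K 0 ()) hA0 hB0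
  refine ⟨K₁, K₂, ?_⟩
  rw [eA, eB]
  exact h

end End

/-! ## §3 Honest located remarks (decided): what the toy makes trivial -/

namespace Sanity

/-- On the toy the RP field is `∫ g·g dδ ≥ 0` for the IDENTITY reflection — reflection positivity proper is not
exercised (BY DESIGN; the by-name producers are rows W3b–W3m). [decided toy] -/
example (g : Unit → ℝ) : 0 ≤ ∫ ω, g (id ω) * g ω ∂(Measure.dirac ()) :=
  integral_nonneg fun ω => mul_self_nonneg (g ω)

/-- On the toy the (U1)+(G2) field holds at rate `0` because the cell events are EMPTY — the universally forced pattern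
is impossible, not rare (BY DESIGN). [decided toy] -/
example : (Measure.dirac ()).real (⋂ c ∈ (Finset.univ : Finset (BlockIdx 1 2)), (∅ : Set Unit)) ≤ (0 : ℝ) ^ (2 ^ 1) := by
  rw [biInter_univ_empty, measureReal_empty]
  positivity

/-- CONTROL (planted false): at the inhabited rate `r = 1` of p220032 §6 the END does NOT apply — a constant rate `1` is
not summable. [decided toy] -/
example : ¬ Summable (fun _ : ℕ => (1 : ℝ)) := by
  intro h
  have := h.tendsto_atTop_zero
  have h1 : Filter.Tendsto (fun _ : ℕ => (1 : ℝ)) Filter.atTop (nhds 1) := tendsto_const_nhds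
  exact one_ne_zero (tendsto_nhds_unique h1 this)

end Sanity

end

end Summit.QuantumFields.BalabanUV.T4Continuum.HistoryChessboardEndWitness
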